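import Mathlib.NumberTheory.ZetaValues
import Mathlib.Analysis.Real.Pi.Bounds
import Mathlib.Data.Nat.Factorization.Basic
import Mathlib.Tactic.IntervalCases
import HarnessLib

/-!
# At least half of the pairs in `[1, M]²` are coprime

Topic `NumberTheory/Sieve`. Theorem-only file (no definitions, no named facts): the explicit,
uniform-in-`M` form of the density `6/π²` of coprime pairs,

  `#{(k, l) ∈ [1, M]² : gcd(k, l) = 1} ≥ M²/2`  (`card_coprime_pairs_ge`),

by the first step of the sieve: a non-coprime pair has a common prime factor `p ≤ M`, the pairs
with `p ∣ k, p ∣ l` number `⌊M/p⌋² ≤ M²/p²` (`card_filter_dvd_dvd`), and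
`∑_{p prime} 1/p² ≤ 1/4 + 1/9 + 1/25 + 1/49 + ¼ ∑_{k ≥ 5} 1/k² < 0.477` (`sum_primes_inv_sq_le`,
the tail through `ζ(2) = π²/6`, Mathlib's `hasSum_zeta_two`, and `π < 3.1416`).

Consumer: the success probability of Hallgren's two-sample recovery of an irrational period
(Jozsa 2003, §10, proof of Thm. 6: "`gcd(k, l) = 1` with probability `1/poly`"; the tree's
`Cryptography/IrrationalPeriodRecovery.lean`, `HallgrenPeriodRecovery.lean`): with each good pair
`(k, l) ∈ [1, M]²` of sample labels having probability `≥ β²`, the coprime ones carry mass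
`≥ β² M²/2`.

## References

* G. H. Hardy, E. M. Wright, *An Introduction to the Theory of Numbers*, 6th ed. 2008, Thm. 332
  (the probability that two integers are coprime is `6/π²`). [HardyWright2008]
* R. Jozsa, arXiv:quant-ph/0302134 (2003), §10 (proof of Thm. 6). [Jozsa2003]
-/

noncomputable section

open Finset Real

namespace Literature.NumberTheory.Sieve.CoprimePairs

/-! ### Pairs with a common prime factor -/

/-- The pairs of `[1, M]²` divisible by `p` in both coordinates number `⌊M/p⌋²`. [folklore] -/
theorem card_filter_dvd_dvd (M p : ℕ) :
    (((Icc 1 M) ×ˢ (Icc 1 M)).filter (fun kl : ℕ × ℕ => p ∣ kl.1 ∧ p ∣ kl.2)).card = (M / p) ^ 2 := by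
  rw [Finset.filter_product (s := Icc 1 M) (t := Icc 1 M) (p := fun k => p ∣ k) (q := fun l => p ∣ l),
    card_product]
  have h : ((Icc 1 M).filter (fun x => p ∣ x)).card = M / p := by
    rw [show Icc 1 M = Ioc 0 M from Finset.Icc_add_one_left_eq_Ioc 0 M]
    exact Nat.Ioc_filter_dvd_card_eq_div M p
  rw [h, sq]

/-- A non-coprime pair of positive integers has a common prime factor at most the first one.
[folklore] -/
theorem exists_prime_dvd_dvd {k l : ℕ} (hk : 1 ≤ k) (h : ¬ Nat.Coprime k l) :
    ∃ p, p.Prime ∧ p ∣ k ∧ p ∣ l ∧ p ≤ k := by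
  obtain ⟨p, hp, hpd⟩ := Nat.exists_prime_and_dvd (n := Nat.gcd k l) h
  refine ⟨p, hp, hpd.trans (Nat.gcd_dvd_left k l), hpd.trans (Nat.gcd_dvd_right k l), ?_⟩
  exact Nat.le_of_dvd (by omega) (hpd.trans (Nat.gcd_dvd_left k l))

/-- **Union bound**: the non-coprime pairs of `[1, M]²` number at most `∑_{p ≤ M prime} ⌊M/p⌋²`.
[cite: HardyWright2008, Thm. 332 (proof idea)] -/
theorem card_filter_not_coprime_le (M : ℕ) :
    ((((Icc 1 M) ×ˢ (Icc 1 M)).filter (fun kl : ℕ × ℕ => ¬ Nat.Coprime kl.1 kl.2)).card : ℝ) ≤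
      ∑ p ∈ (Icc 1 M).filter Nat.Prime, (((M / p) ^ 2 : ℕ) : ℝ) := by
  classical
  have hsub : ((Icc 1 M) ×ˢ (Icc 1 M)).filter (fun kl : ℕ × ℕ => ¬ Nat.Coprime kl.1 kl.2) ⊆
      ((Icc 1 M).filter Nat.Prime).biUnion
        (fun p => ((Icc 1 M) ×ˢ (Icc 1 M)).filter (fun kl : ℕ × ℕ => p ∣ kl.1 ∧ p ∣ kl.2)) := by
    intro kl hkl
    rw [mem_filter, mem_product, mem_Icc, mem_Icc] at hkl
    obtain ⟨⟨⟨hk1, hkM⟩, hl1, hlM⟩, hnc⟩ := hkl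
    obtain ⟨p, hp, hpk, hpl, hple⟩ := exists_prime_dvd_dvd hk1 hnc
    rw [mem_biUnion]
    refine ⟨p, ?_, ?_⟩
    · rw [mem_filter, mem_Icc]; exact ⟨⟨hp.one_lt.le, hple.trans hkM⟩, hp⟩
    · rw [mem_filter, mem_product, mem_Icc, mem_Icc]; exact ⟨⟨⟨hk1, hkM⟩, hl1, hlM⟩, hpk, hpl⟩
  calc ((((Icc 1 M) ×ˢ (Icc 1 M)).filter (fun kl : ℕ × ℕ => ¬ Nat.Coprime kl.1 kl.2)).card : ℝ)
      ≤ ((((Icc 1 M).filter Nat.Prime).biUnion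
          (fun p => ((Icc 1 M) ×ˢ (Icc 1 M)).filter (fun kl : ℕ × ℕ => p ∣ kl.1 ∧ p ∣ kl.2))).card : ℝ) := by
        exact_mod_cast card_le_card hsub
    _ ≤ ∑ p ∈ (Icc 1 M).filter Nat.Prime,
          ((((Icc 1 M) ×ˢ (Icc 1 M)).filter (fun kl : ℕ × ℕ => p ∣ kl.1 ∧ p ∣ kl.2)).card : ℝ) := by
        exact_mod_cast card_biUnion_le
    _ = ∑ p ∈ (Icc 1 M).filter Nat.Prime, (((M / p) ^ 2 : ℕ) : ℝ) := by
        refine sum_congr rfl fun p _ => ?_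
        rw [card_filter_dvd_dvd]

/-! ### `∑_{p prime} 1/p² < 0.477` -/

/-- The tail `∑_{k ≥ 5} 1/k² = π²/6 − (1 + 1/4 + 1/9 + 1/16) < 0.2214`. [folklore] -/
theorem hasSum_inv_sq_tail :
    HasSum (fun j : ℕ => (1 : ℝ) / ((j + 5 : ℕ) : ℝ) ^ 2) (π ^ 2 / 6 - (1 + 1 / 4 + 1 / 9 + 1 / 16)) := by
  have h := (hasSum_nat_add_iff (f := fun n : ℕ => (1 : ℝ) / (n : ℝ) ^ 2) 5).2
    (by
      have h0 : ∑ i ∈ range 5, (1 : ℝ) / (i : ℝ) ^ 2 = 1 + 1 / 4 + 1 / 9 + 1 / 16 := by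
        simp [Finset.sum_range_succ]; norm_num
      rw [h0, sub_add_cancel]; exact hasSum_zeta_two)
  exact h

/-- `π²/6 − (1 + 1/4 + 1/9 + 1/16) < 0.2214`. [folklore] -/
theorem inv_sq_tail_lt : π ^ 2 / 6 - (1 + 1 / 4 + 1 / 9 + 1 / 16) < 0.2214 := by
  have h := Real.pi_lt_d4
  have h0 := Real.pi_pos
  nlinarith

/-- **`∑_{p ≤ M prime} 1/p² ≤ 0.477`**: the primes `2, 3, 5, 7` contribute
`1/4 + 1/9 + 1/25 + 1/49`, and a prime `p ≥ 11` is `2k + 1` with `k ≥ 5`, `1/p² ≤ ¼ · 1/k²`.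
[cite: HardyWright2008, Thm. 332 (proof idea)] -/
theorem sum_primes_inv_sq_le (M : ℕ) :
    ∑ p ∈ (Icc 1 M).filter Nat.Prime, (1 : ℝ) / (p : ℝ) ^ 2 ≤ 0.477 := by
  classical
  set PP := (Icc 1 M).filter Nat.Prime with hPP
  have hsplit : ∑ p ∈ PP, (1 : ℝ) / (p : ℝ) ^ 2 =
      ∑ p ∈ PP.filter (fun p => p < 11), (1 : ℝ) / (p : ℝ) ^ 2 +
        ∑ p ∈ PP.filter (fun p => ¬ p < 11), (1 : ℝ) / (p : ℝ) ^ 2 :=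
    (sum_filter_add_sum_filter_not PP (fun p => p < 11) _).symm
  -- small primes
  have hsmall : ∑ p ∈ PP.filter (fun p => p < 11), (1 : ℝ) / (p : ℝ) ^ 2 ≤
      1 / 4 + 1 / 9 + 1 / 25 + 1 / 49 := by
    have hsub : PP.filter (fun p => p < 11) ⊆ ({2, 3, 5, 7} : Finset ℕ) := by
      intro p hp
      rw [mem_filter, hPP, mem_filter] at hp
      obtain ⟨⟨-, hprime⟩, hlt⟩ := hp
      have h2 := hprime.two_le
      interval_cases p <;> norm_num at hprime ⊢ <;> exact absurd hprime (by decide)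
    calc ∑ p ∈ PP.filter (fun p => p < 11), (1 : ℝ) / (p : ℝ) ^ 2
        ≤ ∑ p ∈ ({2, 3, 5, 7} : Finset ℕ), (1 : ℝ) / (p : ℝ) ^ 2 :=
          sum_le_sum_of_subset_of_nonneg hsub fun _ _ _ => by positivity
      _ = 1 / 4 + 1 / 9 + 1 / 25 + 1 / 49 := by
          rw [sum_insert (by decide), sum_insert (by decide), sum_insert (by decide), sum_singleton]
          norm_num
  -- large primes: reindex by `k = (p - 1)/2 ≥ 5`, `p = 2k + 1`
  set BB := PP.filter (fun p => ¬ p < 11) with hBB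
  have hodd : ∀ p ∈ BB, p = 2 * ((p - 1) / 2) + 1 ∧ 5 ≤ (p - 1) / 2 := by
    intro p hp
    rw [hBB, mem_filter, hPP, mem_filter] at hp
    obtain ⟨⟨-, hprime⟩, hge⟩ := hp
    push Not at hge
    have hodd : p % 2 = 1 := by
      by_contra hc
      have h2 : 2 ∣ p := Nat.dvd_of_mod_eq_zero (by omega)
      rcases hprime.eq_one_or_self_of_dvd 2 h2 with h | h <;> omega
    exact ⟨by omega, by omega⟩
  have hlarge : ∑ p ∈ BB, (1 : ℝ) / (p : ℝ) ^ 2 ≤ (1 / 4) * (π ^ 2 / 6 - (1 + 1 / 4 + 1 / 9 + 1 / 16)) := by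
    -- `1/p² ≤ ¼ · 1/k²`
    have hterm : ∀ p ∈ BB, (1 : ℝ) / (p : ℝ) ^ 2 ≤ (1 / 4) * (1 / ((((p - 1) / 2 - 5 + 5 : ℕ) : ℝ)) ^ 2) := by
      intro p hp
      obtain ⟨hpk, hk5⟩ := hodd p hp
      have hkk : (p - 1) / 2 - 5 + 5 = (p - 1) / 2 := by omega
      rw [hkk]
      set k := (p - 1) / 2 with hk
      have hkR : (5 : ℝ) ≤ k := by exact_mod_cast hk5
      have hpR : (p : ℝ) = 2 * k + 1 := by exact_mod_cast hpk
      rw [hpR]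
      have h4 : (4 : ℝ) * (k : ℝ) ^ 2 ≤ (2 * k + 1) ^ 2 := by nlinarith
      calc (1 : ℝ) / (2 * (k : ℝ) + 1) ^ 2 ≤ 1 / (4 * (k : ℝ) ^ 2) :=
            one_div_le_one_div_of_le (by positivity) h4
        _ = 1 / 4 * (1 / (k : ℝ) ^ 2) := by field_simp
    -- injective reindexing into the tail
    have hinj : Set.InjOn (fun p => (p - 1) / 2 - 5) (BB : Set ℕ) := by
      intro p hp p' hp' h
      obtain ⟨hpk, hk5⟩ := hodd p hp
      obtain ⟨hpk', hk5'⟩ := hodd p' hp'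
      simp only at h
      omega
    calc ∑ p ∈ BB, (1 : ℝ) / (p : ℝ) ^ 2
        ≤ ∑ p ∈ BB, (1 / 4) * (1 / ((((p - 1) / 2 - 5 + 5 : ℕ) : ℝ)) ^ 2) := sum_le_sum hterm
      _ = (1 / 4) * ∑ p ∈ BB, (1 / ((((p - 1) / 2 - 5 + 5 : ℕ) : ℝ)) ^ 2) := by rw [mul_sum]
      _ = (1 / 4) * ∑ j ∈ BB.image (fun p => (p - 1) / 2 - 5), (1 / (((j + 5 : ℕ) : ℝ)) ^ 2) := by
          rw [sum_image hinj]
      _ ≤ (1 / 4) * (π ^ 2 / 6 - (1 + 1 / 4 + 1 / 9 + 1 / 16)) := by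
          apply mul_le_mul_of_nonneg_left _ (by norm_num)
          exact sum_le_hasSum _ (fun j _ => by positivity) hasSum_inv_sq_tail
  have htail := inv_sq_tail_lt
  rw [hsplit]
  have : ∑ p ∈ PP.filter (fun p => ¬ p < 11), (1 : ℝ) / (p : ℝ) ^ 2 = ∑ p ∈ BB, (1 : ℝ) / (p : ℝ) ^ 2 := rfl
  rw [this]
  nlinarith

/-! ### The count -/

/-- **At least half of the pairs in `[1, M]²` are coprime**: `#{(k,l) ∈ [1,M]² : gcd(k,l) = 1} ≥ M²/2`
(indeed `≥ 0.523 M²`), uniformly in `M`. [cite: HardyWright2008, Thm. 332] -/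
theorem card_coprime_pairs_ge (M : ℕ) :
    ((M : ℝ) ^ 2) / 2 ≤ ((((Icc 1 M) ×ˢ (Icc 1 M)).filter (fun kl : ℕ × ℕ => Nat.Coprime kl.1 kl.2)).card : ℝ) := by
  classical
  have htot : ((((Icc 1 M) ×ˢ (Icc 1 M)).filter (fun kl : ℕ × ℕ => Nat.Coprime kl.1 kl.2)).card : ℝ) +
      ((((Icc 1 M) ×ˢ (Icc 1 M)).filter (fun kl : ℕ × ℕ => ¬ Nat.Coprime kl.1 kl.2)).card : ℝ) = (M : ℝ) ^ 2 := by
    have h := card_filter_add_card_filter_not (s := (Icc 1 M) ×ˢ (Icc 1 M)) (fun kl : ℕ × ℕ => Nat.Coprime kl.1 kl.2)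
    rw [card_product, Nat.card_Icc, Nat.add_sub_cancel] at h
    have h' : ((((Icc 1 M) ×ˢ (Icc 1 M)).filter (fun kl : ℕ × ℕ => Nat.Coprime kl.1 kl.2)).card : ℝ) +
        ((((Icc 1 M) ×ˢ (Icc 1 M)).filter (fun kl : ℕ × ℕ => ¬ Nat.Coprime kl.1 kl.2)).card : ℝ) =
          ((M * M : ℕ) : ℝ) := by exact_mod_cast h
    rw [h']; push_cast; ring
  have hbad := card_filter_not_coprime_le M
  have hsum : ∑ p ∈ (Icc 1 M).filter Nat.Prime, (((M / p) ^ 2 : ℕ) : ℝ) ≤ (M : ℝ) ^ 2 * 0.477 := by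
    calc ∑ p ∈ (Icc 1 M).filter Nat.Prime, (((M / p) ^ 2 : ℕ) : ℝ)
        ≤ ∑ p ∈ (Icc 1 M).filter Nat.Prime, (M : ℝ) ^ 2 * (1 / (p : ℝ) ^ 2) := by
          refine sum_le_sum fun p hp => ?_
          rw [mem_filter, mem_Icc] at hp
          have hp0 : (0 : ℝ) < p := by exact_mod_cast hp.1.1
          have hdiv : ((M / p : ℕ) : ℝ) ≤ (M : ℝ) / p := Nat.cast_div_le
          have hnn : (0 : ℝ) ≤ ((M / p : ℕ) : ℝ) := by positivity
          push_cast
          calc ((M / p : ℕ) : ℝ) ^ 2 ≤ ((M : ℝ) / p) ^ 2 := pow_le_pow_left₀ hnn hdiv 2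
            _ = (M : ℝ) ^ 2 * (1 / (p : ℝ) ^ 2) := by field_simp
      _ = (M : ℝ) ^ 2 * ∑ p ∈ (Icc 1 M).filter Nat.Prime, (1 / (p : ℝ) ^ 2) := by rw [mul_sum]
      _ ≤ (M : ℝ) ^ 2 * 0.477 := mul_le_mul_of_nonneg_left (sum_primes_inv_sq_le M) (by positivity)
  nlinarith

end Literature.NumberTheory.Sieve.CoprimePairs

end
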